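import Summits.QuantumFields.YangMills.Theorems.AllWindowsColdBoxBoxHighLineTiltCrossTerm

/-!
# U5 ε₂-glue (G3b-2b): SLOT CALCULUS of the fourth cumulant at `t = 0` over `μ_{D′}` — bilinearity, tilt-slot polarisation, the cross term in Gaussian letters

Free-hands helper of the κ-lineage (ym-line-fcl-p3 g27) for Steps D–E of the NEXT rung U5 (`stub_landauThirdOrder`, LINE-20, ⟨stmt-QuantumFields-24336⟩).
ASSEMBLY-U5 §3 (planner ym-idea-2 g18): `f″(0)/2 = κ₄,₀(c₀, c_T; U, U)/2` over `μ_{D′}`; the cubic-pair term exactly (L3c), the rest by parity + Hölder.  Over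
`μ_D := (volume.restrict D).withDensity (ofReal ∘ gaussWeight β H)` for an ARBITRARY measurable `D` (observables measurable, bounded by `B` on `D`, `D` of positive
Gaussian mass):

* ★`tiltCum4_muSet_zero_add_left/right` — bilinearity of `κ₄,₀` in the two observable slots;
* ★★`tiltCum4_muSet_zero_add_third` — tilt-slot POLARISATION: `κ₄,₀(X,Y; U+V) = κ₄,₀(X,Y; U) + κ₄,₀(X,Y; V) + 2·CROSS_U(X,Y; U,V)`, CROSS written out in the
  tilt letter `U` (`E[X̃ỸŨṼ] − E[X̃Ỹ]E[ŨṼ] − E[X̃Ũ]E[ỸṼ] − E[X̃Ṽ]E[ỸŨ]`);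
* ★`abs_cross_muSet_zero_le_gaussAvg` — for `E₀[1 − 1_D] ≤ τ ≤ 1/2` and ANY constants `a₁ a₂ b₁ b₂`:
  `|CROSS| ≤ 4·√(√(32E₀[1_D(X−a₁)⁴])·√(32E₀[1_D(Y−a₂)⁴]))·√(√(32E₀[1_D(U−b₁)⁴])·√(32E₀[1_D(V−b₂)⁴]))` (✓`abs_cross_le` + ✓`Tilt.tiltExp_centred_pow_four_le` +
  ✓`tiltExp_muSet_zero_le_two_mul_gaussAvg`).

No definitions; standard axioms.  HONEST LABEL: helper-grade glue for U5 prep; U5, ⟨24004⟩, ⟨24336⟩ remain OPEN; route AllWindowsColdBox is DRAFT;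
no crux, rung or summit is proved; the Yang–Mills mass gap is NOT proved by this file; no summit is proved by a line.
-/

set_option autoImplicit false

noncomputable section

open MeasureTheory Set

namespace Summit.QuantumFields.YangMills.Theorems.AllWindowsColdBoxBoxHighLine

namespace GaussRestrict

variable {H : ℕ} {β : ℝ}

/-! ## §2 Over `μ_D` for a general measurable `D` -/

section MuSet

variable (hβ : 0 < β) {D : Set (LandauFree H → E3)} (hDm : MeasurableSet D) (hD : 0 < ∫ a, D.indicator (fun _ => (1 : ℝ)) a * gaussWeight β H a)

/-- Products of observables bounded by `C` on `D`: a pair. -/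
private theorem bdd_mul2 {P Q : (LandauFree H → E3) → ℝ} {C : ℝ} (hC : 0 ≤ C) (hP : ∀ a ∈ D, |P a| ≤ C) (hQ : ∀ a ∈ D, |Q a| ≤ C) :
    ∀ a ∈ D, |P a * Q a| ≤ C ^ 2 := fun a ha => by
  rw [abs_mul, sq]; exact mul_le_mul (hP a ha) (hQ a ha) (abs_nonneg _) hC

/-- Products of observables bounded by `C` on `D`: a triple. -/
private theorem bdd_mul3 {P Q R : (LandauFree H → E3) → ℝ} {C : ℝ} (hC : 0 ≤ C) (hP : ∀ a ∈ D, |P a| ≤ C) (hQ : ∀ a ∈ D, |Q a| ≤ C)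
    (hR : ∀ a ∈ D, |R a| ≤ C) : ∀ a ∈ D, |P a * Q a * R a| ≤ C ^ 3 := fun a ha => by
  rw [abs_mul, pow_succ]; exact mul_le_mul (bdd_mul2 hC hP hQ a ha) (hR a ha) (abs_nonneg _) (sq_nonneg _)

/-- Products of observables bounded by `C` on `D`: a quadruple. -/
private theorem bdd_mul4 {P Q R S : (LandauFree H → E3) → ℝ} {C : ℝ} (hC : 0 ≤ C) (hP : ∀ a ∈ D, |P a| ≤ C) (hQ : ∀ a ∈ D, |Q a| ≤ C)
    (hR : ∀ a ∈ D, |R a| ≤ C) (hS : ∀ a ∈ D, |S a| ≤ C) : ∀ a ∈ D, |P a * Q a * R a * S a| ≤ C ^ 4 := fun a ha => by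
  rw [abs_mul, pow_succ]; exact mul_le_mul (bdd_mul3 hC hP hQ hR a ha) (hS a ha) (abs_nonneg _) (pow_nonneg hC 3)

include hβ hDm hD in
/-- ★ **Additivity of `κ₄,₀` in the FIRST observable slot** over `μ_D`. -/
theorem tiltCum4_muSet_zero_add_left (U : (LandauFree H → E3) → ℝ) {F G Y : (LandauFree H → E3) → ℝ} {B : ℝ} (hB : 0 ≤ B)
    (mF : Measurable F) (mG : Measurable G) (mY : Measurable Y) (mU : Measurable U)
    (bF : ∀ a ∈ D, |F a| ≤ B) (bG : ∀ a ∈ D, |G a| ≤ B) (bY : ∀ a ∈ D, |Y a| ≤ B) (bU : ∀ a ∈ D, |U a| ≤ B) :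
    Tilt.tiltCum4 ((((volume : Measure (LandauFree H → E3)).restrict D).withDensity fun a => ENNReal.ofReal (gaussWeight β H a))) U 0 (fun a => F a + G a) Y =
      Tilt.tiltCum4 ((((volume : Measure (LandauFree H → E3)).restrict D).withDensity fun a => ENNReal.ofReal (gaussWeight β H a))) U 0 F Y +
        Tilt.tiltCum4 ((((volume : Measure (LandauFree H → E3)).restrict D).withDensity fun a => ENNReal.ofReal (gaussWeight β H a))) U 0 G Y := by
  set μD := (((volume : Measure (LandauFree H → E3)).restrict D).withDensity fun a => ENNReal.ofReal (gaussWeight β H a)) with hμD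
  unfold Tilt.tiltCum4
  rw [tiltExp_muSet_zero_add hβ hDm U hB mF mG bF bG]
  set mF' := Tilt.tiltExp μD U 0 F
  set mG' := Tilt.tiltExp μD U 0 G
  set mY' := Tilt.tiltExp μD U 0 Y
  set mU' := Tilt.tiltExp μD U 0 U
  have bmF : |mF'| ≤ B := abs_tiltExp_muSet_zero_le hβ hDm hD U hB bF
  have bmG : |mG'| ≤ B := abs_tiltExp_muSet_zero_le hβ hDm hD U hB bG
  have bmY : |mY'| ≤ B := abs_tiltExp_muSet_zero_le hβ hDm hD U hB bY
  have bmU : |mU'| ≤ B := abs_tiltExp_muSet_zero_le hβ hDm hD U hB bU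
  have h2B : 0 ≤ 2 * B := by linarith
  have cen : ∀ {W : (LandauFree H → E3) → ℝ} {m : ℝ}, (∀ a ∈ D, |W a| ≤ B) → |m| ≤ B → ∀ a ∈ D, |W a - m| ≤ 2 * B :=
    fun hW hm a ha => (abs_sub _ _).trans (by linarith [hW a ha])
  have cF := cen bF bmF
  have cG := cen bG bmG
  have cY := cen bY bmY
  have cU := cen bU bmU
  have mcF : Measurable fun a => F a - mF' := mF.sub measurable_const
  have mcG : Measurable fun a => G a - mG' := mG.sub measurable_const
  have mcY : Measurable fun a => Y a - mY' := mY.sub measurable_const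
  have mcU : Measurable fun a => U a - mU' := mU.sub measurable_const
  -- the three integrands split
  have e1 : (fun a => (F a + G a - (mF' + mG')) * (Y a - mY') * (U a - mU') ^ 2) =
      fun a => (F a - mF') * (Y a - mY') * (U a - mU') * (U a - mU') + (G a - mG') * (Y a - mY') * (U a - mU') * (U a - mU') := by funext a; ring
  have e2 : (fun a => (F a + G a - (mF' + mG')) * (Y a - mY')) = fun a => (F a - mF') * (Y a - mY') + (G a - mG') * (Y a - mY') := by funext a; ring
  have e3 : (fun a => (F a + G a - (mF' + mG')) * (U a - mU')) = fun a => (F a - mF') * (U a - mU') + (G a - mG') * (U a - mU') := by funext a; ring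
  have eF : (fun a => (F a - mF') * (Y a - mY') * (U a - mU') ^ 2) = fun a => (F a - mF') * (Y a - mY') * (U a - mU') * (U a - mU') := by funext a; ring
  have eG : (fun a => (G a - mG') * (Y a - mY') * (U a - mU') ^ 2) = fun a => (G a - mG') * (Y a - mY') * (U a - mU') * (U a - mU') := by funext a; ring
  rw [e1, e2, e3, eF, eG]
  have n1 : Measurable fun a => (F a - mF') * (Y a - mY') * (U a - mU') * (U a - mU') := ((mcF.mul mcY).mul mcU).mul mcU
  have n2 : Measurable fun a => (G a - mG') * (Y a - mY') * (U a - mU') * (U a - mU') := ((mcG.mul mcY).mul mcU).mul mcU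
  have n3 : Measurable fun a => (F a - mF') * (Y a - mY') := mcF.mul mcY
  have n4 : Measurable fun a => (G a - mG') * (Y a - mY') := mcG.mul mcY
  have n5 : Measurable fun a => (F a - mF') * (U a - mU') := mcF.mul mcU
  have n6 : Measurable fun a => (G a - mG') * (U a - mU') := mcG.mul mcU
  rw [tiltExp_muSet_zero_add hβ hDm U (pow_nonneg h2B 4) n1 n2 (bdd_mul4 h2B cF cY cU cU) (bdd_mul4 h2B cG cY cU cU),
    tiltExp_muSet_zero_add hβ hDm U (pow_nonneg h2B 2) n3 n4 (bdd_mul2 h2B cF cY) (bdd_mul2 h2B cG cY),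
    tiltExp_muSet_zero_add hβ hDm U (pow_nonneg h2B 2) n5 n6 (bdd_mul2 h2B cF cU) (bdd_mul2 h2B cG cU)]
  ring

include hβ hDm hD in
/-- ★ **Additivity of `κ₄,₀` in the SECOND observable slot** over `μ_D`. -/
theorem tiltCum4_muSet_zero_add_right (U : (LandauFree H → E3) → ℝ) {X F G : (LandauFree H → E3) → ℝ} {B : ℝ} (hB : 0 ≤ B)
    (mX : Measurable X) (mF : Measurable F) (mG : Measurable G) (mU : Measurable U)
    (bX : ∀ a ∈ D, |X a| ≤ B) (bF : ∀ a ∈ D, |F a| ≤ B) (bG : ∀ a ∈ D, |G a| ≤ B) (bU : ∀ a ∈ D, |U a| ≤ B) :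
    Tilt.tiltCum4 ((((volume : Measure (LandauFree H → E3)).restrict D).withDensity fun a => ENNReal.ofReal (gaussWeight β H a))) U 0 X (fun a => F a + G a) =
      Tilt.tiltCum4 ((((volume : Measure (LandauFree H → E3)).restrict D).withDensity fun a => ENNReal.ofReal (gaussWeight β H a))) U 0 X F +
        Tilt.tiltCum4 ((((volume : Measure (LandauFree H → E3)).restrict D).withDensity fun a => ENNReal.ofReal (gaussWeight β H a))) U 0 X G := by
  set μD := (((volume : Measure (LandauFree H → E3)).restrict D).withDensity fun a => ENNReal.ofReal (gaussWeight β H a)) with hμD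
  unfold Tilt.tiltCum4
  rw [tiltExp_muSet_zero_add hβ hDm U hB mF mG bF bG]
  set mX' := Tilt.tiltExp μD U 0 X
  set mF' := Tilt.tiltExp μD U 0 F
  set mG' := Tilt.tiltExp μD U 0 G
  set mU' := Tilt.tiltExp μD U 0 U
  have bmX : |mX'| ≤ B := abs_tiltExp_muSet_zero_le hβ hDm hD U hB bX
  have bmF : |mF'| ≤ B := abs_tiltExp_muSet_zero_le hβ hDm hD U hB bF
  have bmG : |mG'| ≤ B := abs_tiltExp_muSet_zero_le hβ hDm hD U hB bG
  have bmU : |mU'| ≤ B := abs_tiltExp_muSet_zero_le hβ hDm hD U hB bU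
  have h2B : 0 ≤ 2 * B := by linarith
  have cen : ∀ {W : (LandauFree H → E3) → ℝ} {m : ℝ}, (∀ a ∈ D, |W a| ≤ B) → |m| ≤ B → ∀ a ∈ D, |W a - m| ≤ 2 * B :=
    fun hW hm a ha => (abs_sub _ _).trans (by linarith [hW a ha])
  have cX := cen bX bmX
  have cF := cen bF bmF
  have cG := cen bG bmG
  have cU := cen bU bmU
  have mcX : Measurable fun a => X a - mX' := mX.sub measurable_const
  have mcF : Measurable fun a => F a - mF' := mF.sub measurable_const
  have mcG : Measurable fun a => G a - mG' := mG.sub measurable_const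
  have mcU : Measurable fun a => U a - mU' := mU.sub measurable_const
  have e1 : (fun a => (X a - mX') * (F a + G a - (mF' + mG')) * (U a - mU') ^ 2) =
      fun a => (X a - mX') * (F a - mF') * (U a - mU') * (U a - mU') + (X a - mX') * (G a - mG') * (U a - mU') * (U a - mU') := by funext a; ring
  have e2 : (fun a => (X a - mX') * (F a + G a - (mF' + mG'))) = fun a => (X a - mX') * (F a - mF') + (X a - mX') * (G a - mG') := by funext a; ring
  have e3 : (fun a => (F a + G a - (mF' + mG')) * (U a - mU')) = fun a => (F a - mF') * (U a - mU') + (G a - mG') * (U a - mU') := by funext a; ring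
  have eF : (fun a => (X a - mX') * (F a - mF') * (U a - mU') ^ 2) = fun a => (X a - mX') * (F a - mF') * (U a - mU') * (U a - mU') := by funext a; ring
  have eG : (fun a => (X a - mX') * (G a - mG') * (U a - mU') ^ 2) = fun a => (X a - mX') * (G a - mG') * (U a - mU') * (U a - mU') := by funext a; ring
  rw [e1, e2, e3, eF, eG]
  have n1 : Measurable fun a => (X a - mX') * (F a - mF') * (U a - mU') * (U a - mU') := ((mcX.mul mcF).mul mcU).mul mcU
  have n2 : Measurable fun a => (X a - mX') * (G a - mG') * (U a - mU') * (U a - mU') := ((mcX.mul mcG).mul mcU).mul mcU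
  have n3 : Measurable fun a => (X a - mX') * (F a - mF') := mcX.mul mcF
  have n4 : Measurable fun a => (X a - mX') * (G a - mG') := mcX.mul mcG
  have n5 : Measurable fun a => (F a - mF') * (U a - mU') := mcF.mul mcU
  have n6 : Measurable fun a => (G a - mG') * (U a - mU') := mcG.mul mcU
  rw [tiltExp_muSet_zero_add hβ hDm U (pow_nonneg h2B 4) n1 n2 (bdd_mul4 h2B cX cF cU cU) (bdd_mul4 h2B cX cG cU cU),
    tiltExp_muSet_zero_add hβ hDm U (pow_nonneg h2B 2) n3 n4 (bdd_mul2 h2B cX cF) (bdd_mul2 h2B cX cG),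
    tiltExp_muSet_zero_add hβ hDm U (pow_nonneg h2B 2) n5 n6 (bdd_mul2 h2B cF cU) (bdd_mul2 h2B cG cU)]
  ring

include hβ hDm hD in
/-- ★★ **Tilt-slot POLARISATION of `κ₄,₀` over `μ_D`**: for observables measurable and bounded by `B` on `D`,
`κ₄,₀(X,Y; U+V) = κ₄,₀(X,Y; U) + κ₄,₀(X,Y; V) + 2·(E[X̃ỸŨṼ] − E[X̃Ỹ]E[ŨṼ] − E[X̃Ũ]E[ỸṼ] − E[X̃Ṽ]E[ỸŨ])`, all expectations and centrings in the
tilt letter `U` at `t = 0` (the CROSS term; bounded by ✓`abs_cross_le` / `abs_cross_muSet_zero_le_gaussAvg`). -/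
theorem tiltCum4_muSet_zero_add_third {X Y U V : (LandauFree H → E3) → ℝ} {B : ℝ} (hB : 0 ≤ B)
    (mX : Measurable X) (mY : Measurable Y) (mU : Measurable U) (mV : Measurable V)
    (bX : ∀ a ∈ D, |X a| ≤ B) (bY : ∀ a ∈ D, |Y a| ≤ B) (bU : ∀ a ∈ D, |U a| ≤ B) (bV : ∀ a ∈ D, |V a| ≤ B) :
    let μD : Measure (LandauFree H → E3) := (((volume : Measure (LandauFree H → E3)).restrict D).withDensity fun a => ENNReal.ofReal (gaussWeight β H a))
    let E : ((LandauFree H → E3) → ℝ) → ℝ := fun G => Tilt.tiltExp μD U 0 G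
    Tilt.tiltCum4 μD (fun a => U a + V a) 0 X Y =
      Tilt.tiltCum4 μD U 0 X Y + Tilt.tiltCum4 μD V 0 X Y +
        2 * (E (fun a => (X a - E X) * (Y a - E Y) * (U a - E U) * (V a - E V)) - E (fun a => (X a - E X) * (Y a - E Y)) * E (fun a => (U a - E U) * (V a - E V))
          - E (fun a => (X a - E X) * (U a - E U)) * E (fun a => (Y a - E Y) * (V a - E V))
          - E (fun a => (X a - E X) * (V a - E V)) * E (fun a => (Y a - E Y) * (U a - E U))) := by
  intro μD E
  -- everything in the tilt letter `U`
  rw [tiltCum4_zero_eq_quad μD (fun a => U a + V a) U X Y, tiltCum4_zero_eq_quad μD V U X Y]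
  unfold Tilt.tiltCum4
  simp only [E]
  rw [tiltExp_muSet_zero_add hβ hDm U hB mU mV bU bV]
  set mX' := Tilt.tiltExp μD U 0 X
  set mY' := Tilt.tiltExp μD U 0 Y
  set mU' := Tilt.tiltExp μD U 0 U
  set mV' := Tilt.tiltExp μD U 0 V
  have bmX : |mX'| ≤ B := abs_tiltExp_muSet_zero_le hβ hDm hD U hB bX
  have bmY : |mY'| ≤ B := abs_tiltExp_muSet_zero_le hβ hDm hD U hB bY
  have bmU : |mU'| ≤ B := abs_tiltExp_muSet_zero_le hβ hDm hD U hB bU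
  have bmV : |mV'| ≤ B := abs_tiltExp_muSet_zero_le hβ hDm hD U hB bV
  have h2B : 0 ≤ 2 * B := by linarith
  have cen : ∀ {W : (LandauFree H → E3) → ℝ} {m : ℝ}, (∀ a ∈ D, |W a| ≤ B) → |m| ≤ B → ∀ a ∈ D, |W a - m| ≤ 2 * B :=
    fun hW hm a ha => (abs_sub _ _).trans (by linarith [hW a ha])
  have cX := cen bX bmX
  have cY := cen bY bmY
  have cU := cen bU bmU
  have cV := cen bV bmV
  have mcX : Measurable fun a => X a - mX' := mX.sub measurable_const
  have mcY : Measurable fun a => Y a - mY' := mY.sub measurable_const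
  have mcU : Measurable fun a => U a - mU' := mU.sub measurable_const
  have mcV : Measurable fun a => V a - mV' := mV.sub measurable_const
  -- expand the three integrands that contain `U + V`
  have e1 : (fun a => (X a - mX') * (Y a - mY') * (U a + V a - (mU' + mV')) ^ 2) =
      fun a => ((X a - mX') * (Y a - mY') * (U a - mU') * (U a - mU') + (X a - mX') * (Y a - mY') * (V a - mV') * (V a - mV')) +
        (2 : ℝ) * ((X a - mX') * (Y a - mY') * (U a - mU') * (V a - mV')) := by funext a; ring
  have e2 : (fun a => (U a + V a - (mU' + mV')) ^ 2) =
      fun a => ((U a - mU') * (U a - mU') + (V a - mV') * (V a - mV')) + (2 : ℝ) * ((U a - mU') * (V a - mV')) := by funext a; ring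
  have e3 : (fun a => (X a - mX') * (U a + V a - (mU' + mV'))) = fun a => (X a - mX') * (U a - mU') + (X a - mX') * (V a - mV') := by funext a; ring
  have e4 : (fun a => (Y a - mY') * (U a + V a - (mU' + mV'))) = fun a => (Y a - mY') * (U a - mU') + (Y a - mY') * (V a - mV') := by funext a; ring
  have eU1 : (fun a => (X a - mX') * (Y a - mY') * (U a - mU') ^ 2) = fun a => (X a - mX') * (Y a - mY') * (U a - mU') * (U a - mU') := by funext a; ring
  have eV1 : (fun a => (X a - mX') * (Y a - mY') * (V a - mV') ^ 2) = fun a => (X a - mX') * (Y a - mY') * (V a - mV') * (V a - mV') := by funext a; ring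
  have eU2 : (fun a => (U a - mU') ^ 2) = fun a => (U a - mU') * (U a - mU') := by funext a; ring
  have eV2 : (fun a => (V a - mV') ^ 2) = fun a => (V a - mV') * (V a - mV') := by funext a; ring
  rw [e1, e2, e3, e4, eU1, eV1, eU2, eV2]
  -- linearity, term by term
  have n1 : Measurable fun a => (X a - mX') * (Y a - mY') * (U a - mU') * (U a - mU') := ((mcX.mul mcY).mul mcU).mul mcU
  have n2 : Measurable fun a => (X a - mX') * (Y a - mY') * (V a - mV') * (V a - mV') := ((mcX.mul mcY).mul mcV).mul mcV
  have n12 : Measurable fun a => (X a - mX') * (Y a - mY') * (U a - mU') * (U a - mU') + (X a - mX') * (Y a - mY') * (V a - mV') * (V a - mV') := n1.add n2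
  have n3 : Measurable fun a => (2 : ℝ) * ((X a - mX') * (Y a - mY') * (U a - mU') * (V a - mV')) := ((((mcX.mul mcY).mul mcU).mul mcV)).const_mul 2
  have n4 : Measurable fun a => (U a - mU') * (U a - mU') := mcU.mul mcU
  have n5 : Measurable fun a => (V a - mV') * (V a - mV') := mcV.mul mcV
  have n45 : Measurable fun a => (U a - mU') * (U a - mU') + (V a - mV') * (V a - mV') := n4.add n5
  have n6 : Measurable fun a => (2 : ℝ) * ((U a - mU') * (V a - mV')) := (mcU.mul mcV).const_mul 2
  have n7 : Measurable fun a => (X a - mX') * (U a - mU') := mcX.mul mcU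
  have n8 : Measurable fun a => (X a - mX') * (V a - mV') := mcX.mul mcV
  have n9 : Measurable fun a => (Y a - mY') * (U a - mU') := mcY.mul mcU
  have n10 : Measurable fun a => (Y a - mY') * (V a - mV') := mcY.mul mcV
  have b1b : ∀ a ∈ D, |(2 : ℝ) * ((X a - mX') * (Y a - mY') * (U a - mU') * (V a - mV'))| ≤ 2 * (2 * B) ^ 4 := fun a ha => by
    rw [abs_mul, abs_two]; exact mul_le_mul_of_nonneg_left (bdd_mul4 h2B cX cY cU cV a ha) zero_le_two
  have b1a : ∀ a ∈ D, |(X a - mX') * (Y a - mY') * (U a - mU') * (U a - mU') + (X a - mX') * (Y a - mY') * (V a - mV') * (V a - mV')| ≤ 2 * (2 * B) ^ 4 :=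
    fun a ha => (abs_add_le _ _).trans (by linarith [bdd_mul4 h2B cX cY cU cU a ha, bdd_mul4 h2B cX cY cV cV a ha])
  have b2b : ∀ a ∈ D, |(2 : ℝ) * ((U a - mU') * (V a - mV'))| ≤ 2 * (2 * B) ^ 2 := fun a ha => by
    rw [abs_mul, abs_two]; exact mul_le_mul_of_nonneg_left (bdd_mul2 h2B cU cV a ha) zero_le_two
  have b2a : ∀ a ∈ D, |(U a - mU') * (U a - mU') + (V a - mV') * (V a - mV')| ≤ 2 * (2 * B) ^ 2 :=
    fun a ha => (abs_add_le _ _).trans (by linarith [bdd_mul2 h2B cU cU a ha, bdd_mul2 h2B cV cV a ha])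
  rw [tiltExp_muSet_zero_add hβ hDm U (by positivity : (0 : ℝ) ≤ 2 * (2 * B) ^ 4) n12 n3 b1a b1b,
    tiltExp_muSet_zero_add hβ hDm U (pow_nonneg h2B 4) n1 n2 (bdd_mul4 h2B cX cY cU cU) (bdd_mul4 h2B cX cY cV cV),
    tiltExp_muSet_zero_add hβ hDm U (by positivity : (0 : ℝ) ≤ 2 * (2 * B) ^ 2) n45 n6 b2a b2b,
    tiltExp_muSet_zero_add hβ hDm U (pow_nonneg h2B 2) n4 n5 (bdd_mul2 h2B cU cU) (bdd_mul2 h2B cV cV),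
    tiltExp_muSet_zero_add hβ hDm U (pow_nonneg h2B 2) n7 n8 (bdd_mul2 h2B cX cU) (bdd_mul2 h2B cX cV),
    tiltExp_muSet_zero_add hβ hDm U (pow_nonneg h2B 2) n9 n10 (bdd_mul2 h2B cY cU) (bdd_mul2 h2B cY cV),
    Tilt.tiltExp_const_mul, Tilt.tiltExp_const_mul]
  ring

include hβ hDm in
/-- ★ **The CROSS term over `μ_D` in Gaussian letters**: `E₀[1 − 1_D] ≤ τ ≤ 1/2`; `X Y U V` measurable, bounded by `B` on `D`; then for ANY constants
`a₁ a₂ b₁ b₂` (re-centring ✓`Tilt.tiltExp_centred_pow_four_le`, moments ✓`tiltExp_muSet_zero_le_two_mul_gaussAvg`):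
`|CROSS_U(X,Y;U,V)| ≤ 4·√(√(32·E₀[1_D(X−a₁)⁴])·√(32·E₀[1_D(Y−a₂)⁴]))·√(√(32·E₀[1_D(U−b₁)⁴])·√(32·E₀[1_D(V−b₂)⁴]))`. -/
theorem abs_cross_muSet_zero_le_gaussAvg {τ : ℝ} (hτ : gaussAvg β H (fun a => 1 - D.indicator (fun _ => (1 : ℝ)) a) ≤ τ) (hτ2 : τ ≤ 1 / 2)
    {X Y U V : (LandauFree H → E3) → ℝ} {B : ℝ} (hB : 0 ≤ B) (mX : Measurable X) (mY : Measurable Y) (mU : Measurable U) (mV : Measurable V)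
    (bX : ∀ a ∈ D, |X a| ≤ B) (bY : ∀ a ∈ D, |Y a| ≤ B) (bU : ∀ a ∈ D, |U a| ≤ B) (bV : ∀ a ∈ D, |V a| ≤ B) (a₁ a₂ b₁ b₂ : ℝ) :
    let μD : Measure (LandauFree H → E3) := (((volume : Measure (LandauFree H → E3)).restrict D).withDensity fun a => ENNReal.ofReal (gaussWeight β H a))
    let E : ((LandauFree H → E3) → ℝ) → ℝ := fun G => Tilt.tiltExp μD U 0 G
    |E (fun a => (X a - E X) * (Y a - E Y) * (U a - E U) * (V a - E V)) - E (fun a => (X a - E X) * (Y a - E Y)) * E (fun a => (U a - E U) * (V a - E V))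
        - E (fun a => (X a - E X) * (U a - E U)) * E (fun a => (Y a - E Y) * (V a - E V))
        - E (fun a => (X a - E X) * (V a - E V)) * E (fun a => (Y a - E Y) * (U a - E U))| ≤
      4 * (Real.sqrt (Real.sqrt (32 * gaussAvg β H (fun a => D.indicator (fun _ => (1 : ℝ)) a * (X a - a₁) ^ 4)) *
            Real.sqrt (32 * gaussAvg β H (fun a => D.indicator (fun _ => (1 : ℝ)) a * (Y a - a₂) ^ 4))) *
          Real.sqrt (Real.sqrt (32 * gaussAvg β H (fun a => D.indicator (fun _ => (1 : ℝ)) a * (U a - b₁) ^ 4)) *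
            Real.sqrt (32 * gaussAvg β H (fun a => D.indicator (fun _ => (1 : ℝ)) a * (V a - b₂) ^ 4)))) := by
  intro μD E
  have hD := integral_indicator_mul_gaussWeight_pos hβ hDm hτ hτ2
  haveI := isFiniteMeasure_muSet hβ D
  haveI := neZero_muSet hβ hDm hD
  -- pass to the `D`-truncations (globally bounded), which agree with the observables `μ_D`-a.e.
  have mI : Measurable (D.indicator (fun _ => (1 : ℝ))) := measurable_const.indicator hDm
  have aX := ae_muSet_eq_indicator_mul β hDm X
  have aY := ae_muSet_eq_indicator_mul β hDm Y
  have aU := ae_muSet_eq_indicator_mul β hDm U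
  have aV := ae_muSet_eq_indicator_mul β hDm V
  set X' : (LandauFree H → E3) → ℝ := fun a => D.indicator (fun _ => (1 : ℝ)) a * X a with hX'
  set Y' : (LandauFree H → E3) → ℝ := fun a => D.indicator (fun _ => (1 : ℝ)) a * Y a with hY'
  set U' : (LandauFree H → E3) → ℝ := fun a => D.indicator (fun _ => (1 : ℝ)) a * U a with hU'
  set V' : (LandauFree H → E3) → ℝ := fun a => D.indicator (fun _ => (1 : ℝ)) a * V a with hV'
  have mX' : Measurable X' := mI.mul mX
  have mY' : Measurable Y' := mI.mul mY
  have mU' : Measurable U' := mI.mul mU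
  have mV' : Measurable V' := mI.mul mV
  have bX' : ∀ a, |X' a| ≤ B := abs_indicator_one_mul_le hB bX
  have bY' : ∀ a, |Y' a| ≤ B := abs_indicator_one_mul_le hB bY
  have bU' : ∀ a, |U' a| ≤ B := abs_indicator_one_mul_le hB bU
  have bV' : ∀ a, |V' a| ≤ B := abs_indicator_one_mul_le hB bV
  -- every expectation in the statement is unchanged under the truncation
  have hE : ∀ {G G' : (LandauFree H → E3) → ℝ}, G =ᵐ[μD] G' → E G = Tilt.tiltExp μD U' 0 G' := fun h => Tilt.tiltExp_congr_ae aU h 0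
  have cgX := hE aX
  have cgY := hE aY
  have cgU := hE aU
  have cgV := hE aV
  -- the centred products, a.e.
  have prod4 : (fun a => (X a - E X) * (Y a - E Y) * (U a - E U) * (V a - E V)) =ᵐ[μD]
      fun a => (X' a - Tilt.tiltExp μD U' 0 X') * (Y' a - Tilt.tiltExp μD U' 0 Y') * (U' a - Tilt.tiltExp μD U' 0 U') * (V' a - Tilt.tiltExp μD U' 0 V') := by
    filter_upwards [aX, aY, aU, aV] with a hx hy hu hv
    rw [← hx, ← hy, ← hu, ← hv, cgX, cgY, cgU, cgV]
  have prod2 : ∀ {P Q P' Q' : (LandauFree H → E3) → ℝ}, P =ᵐ[μD] P' → Q =ᵐ[μD] Q' →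
      (fun a => (P a - E P) * (Q a - E Q)) =ᵐ[μD] fun a => (P' a - Tilt.tiltExp μD U' 0 P') * (Q' a - Tilt.tiltExp μD U' 0 Q') := by
    intro P Q P' Q' hP hQ
    filter_upwards [hP, hQ] with a hp hq
    rw [← hp, ← hq, hE hP, hE hQ]
  rw [hE prod4, hE (prod2 aX aY), hE (prod2 aU aV), hE (prod2 aX aU), hE (prod2 aY aV), hE (prod2 aX aV), hE (prod2 aY aU)]
  have h := abs_cross_le (μ := μD) mU' mX' mY' mU' mV' bU' bX' bY' bU' bV' 0
  refine h.trans ?_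
  -- each centred fourth moment: re-centre at the constant, then transfer to Gaussian letters
  have four : ∀ {P P' : (LandauFree H → E3) → ℝ} (c : ℝ), Measurable P → (∀ a ∈ D, |P a| ≤ B) →
      P' = (fun a => D.indicator (fun _ => (1 : ℝ)) a * P a) →
      Tilt.tiltExp μD U' 0 (fun a => (P' a - Tilt.tiltExp μD U' 0 P') ^ 4) ≤
        32 * gaussAvg β H (fun a => D.indicator (fun _ => (1 : ℝ)) a * (P a - c) ^ 4) := by
    intro P P' c mP bP hP'
    have mP' : Measurable P' := by rw [hP']; exact mI.mul mP
    have bP' : ∀ a, |P' a| ≤ B := by rw [hP']; exact abs_indicator_one_mul_le hB bP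
    have h1 := Tilt.tiltExp_centred_pow_four_le (μ := μD) mU' mP' bU' bP' 0 c
    have eq1 : Tilt.tiltExp μD U' 0 (fun a => (P' a - c) ^ 4) =
        Tilt.tiltExp μD U' 0 (fun a => D.indicator (fun _ => (1 : ℝ)) a * (P a - c) ^ 4) := by
      refine tiltExp_muSet_congr_on β hDm U' 0 fun a ha => ?_
      rw [hP']
      simp only [Set.indicator_of_mem ha, one_mul]
    have h0 : 0 ≤ fun a => D.indicator (fun _ => (1 : ℝ)) a * (P a - c) ^ 4 := fun a =>
      mul_nonneg (indicator_one_nonneg_le_one D a).1 (by positivity)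
    have hI : Integrable fun a => D.indicator (fun _ => (1 : ℝ)) a * (P a - c) ^ 4 * gaussWeight β H a :=
      Tilt.integrable_bdd_mul_gaussWeight H hβ (mI.mul ((mP.sub measurable_const).pow_const 4)) (C := (B + |c|) ^ 4) fun a => by
        by_cases ha : a ∈ D
        · rw [Set.indicator_of_mem ha, one_mul, abs_pow]
          exact pow_le_pow_left₀ (abs_nonneg _) ((abs_sub _ _).trans (add_le_add (bP a ha) le_rfl)) 4
        · rw [Set.indicator_of_notMem ha, zero_mul, abs_zero]; positivity
    have h2 := tiltExp_muSet_zero_le_two_mul_gaussAvg hβ hDm hτ hτ2 U' h0 hI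
    rw [eq1] at h1
    linarith
  have kX := four a₁ mX bX hX'
  have kY := four a₂ mY bY hY'
  have kU := four b₁ mU bU hU'
  have kV := four b₂ mV bV hV'
  gcongr

end MuSet

/-! ## Homogeneity of `κ₄,₀` (any measure, any tilt letter at `t = 0`) -/

/-- **Homogeneity of `κ₄,₀` in the first observable slot**: `κ₄,₀(c·X, Y; U) = c·κ₄,₀(X, Y; U)`. -/
theorem tiltCum4_zero_const_mul_left {Ω : Type*} [MeasurableSpace Ω] (μ : Measure Ω) (U X Y : Ω → ℝ) (c : ℝ) :
    Tilt.tiltCum4 μ U 0 (fun x => c * X x) Y = c * Tilt.tiltCum4 μ U 0 X Y := by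
  unfold Tilt.tiltCum4
  rw [Tilt.tiltExp_const_mul U 0 c X]
  beta_reduce
  have e1 : (fun x => (c * X x - c * Tilt.tiltExp μ U 0 X) * (Y x - Tilt.tiltExp μ U 0 Y) * (U x - Tilt.tiltExp μ U 0 U) ^ 2) =
      fun x => c * ((X x - Tilt.tiltExp μ U 0 X) * (Y x - Tilt.tiltExp μ U 0 Y) * (U x - Tilt.tiltExp μ U 0 U) ^ 2) := by funext x; ring
  have e2 : (fun x => (c * X x - c * Tilt.tiltExp μ U 0 X) * (Y x - Tilt.tiltExp μ U 0 Y)) =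
      fun x => c * ((X x - Tilt.tiltExp μ U 0 X) * (Y x - Tilt.tiltExp μ U 0 Y)) := by funext x; ring
  have e3 : (fun x => (c * X x - c * Tilt.tiltExp μ U 0 X) * (U x - Tilt.tiltExp μ U 0 U)) =
      fun x => c * ((X x - Tilt.tiltExp μ U 0 X) * (U x - Tilt.tiltExp μ U 0 U)) := by funext x; ring
  rw [e1, e2, e3, Tilt.tiltExp_const_mul, Tilt.tiltExp_const_mul, Tilt.tiltExp_const_mul]
  ring

/-- **Homogeneity of `κ₄,₀` in the second observable slot.** -/
theorem tiltCum4_zero_const_mul_right {Ω : Type*} [MeasurableSpace Ω] (μ : Measure Ω) (U X Y : Ω → ℝ) (c : ℝ) :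
    Tilt.tiltCum4 μ U 0 X (fun x => c * Y x) = c * Tilt.tiltCum4 μ U 0 X Y := by
  unfold Tilt.tiltCum4
  rw [Tilt.tiltExp_const_mul U 0 c Y]
  beta_reduce
  have e1 : (fun x => (X x - Tilt.tiltExp μ U 0 X) * (c * Y x - c * Tilt.tiltExp μ U 0 Y) * (U x - Tilt.tiltExp μ U 0 U) ^ 2) =
      fun x => c * ((X x - Tilt.tiltExp μ U 0 X) * (Y x - Tilt.tiltExp μ U 0 Y) * (U x - Tilt.tiltExp μ U 0 U) ^ 2) := by funext x; ring
  have e2 : (fun x => (X x - Tilt.tiltExp μ U 0 X) * (c * Y x - c * Tilt.tiltExp μ U 0 Y)) =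
      fun x => c * ((X x - Tilt.tiltExp μ U 0 X) * (Y x - Tilt.tiltExp μ U 0 Y)) := by funext x; ring
  have e3 : (fun x => (c * Y x - c * Tilt.tiltExp μ U 0 Y) * (U x - Tilt.tiltExp μ U 0 U)) =
      fun x => c * ((Y x - Tilt.tiltExp μ U 0 Y) * (U x - Tilt.tiltExp μ U 0 U)) := by funext x; ring
  rw [e1, e2, e3, Tilt.tiltExp_const_mul, Tilt.tiltExp_const_mul, Tilt.tiltExp_const_mul]
  ring

/-- **Homogeneity of `κ₄,₀` in the tilt slot (quadratic)**: `κ₄,₀(X, Y; c·U) = c²·κ₄,₀(X, Y; U)` — in particular `κ₄,₀(X,Y;−U) = κ₄,₀(X,Y;U)`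
(the tilt exponent contains `−cubicVertex`, LEAD's C4 is stated for `+`). -/
theorem tiltCum4_zero_const_mul_third {Ω : Type*} [MeasurableSpace Ω] (μ : Measure Ω) (U X Y : Ω → ℝ) (c : ℝ) :
    Tilt.tiltCum4 μ (fun x => c * U x) 0 X Y = c ^ 2 * Tilt.tiltCum4 μ U 0 X Y := by
  rw [tiltCum4_zero_eq_quad μ (fun x => c * U x) U X Y]
  unfold Tilt.tiltCum4
  rw [Tilt.tiltExp_const_mul U 0 c U]
  have e1 : (fun x => (X x - Tilt.tiltExp μ U 0 X) * (Y x - Tilt.tiltExp μ U 0 Y) * (c * U x - c * Tilt.tiltExp μ U 0 U) ^ 2) =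
      fun x => c ^ 2 * ((X x - Tilt.tiltExp μ U 0 X) * (Y x - Tilt.tiltExp μ U 0 Y) * (U x - Tilt.tiltExp μ U 0 U) ^ 2) := by funext x; ring
  have e2 : (fun x => (c * U x - c * Tilt.tiltExp μ U 0 U) ^ 2) = fun x => c ^ 2 * ((U x - Tilt.tiltExp μ U 0 U) ^ 2) := by funext x; ring
  have e3 : (fun x => (X x - Tilt.tiltExp μ U 0 X) * (c * U x - c * Tilt.tiltExp μ U 0 U)) =
      fun x => c * ((X x - Tilt.tiltExp μ U 0 X) * (U x - Tilt.tiltExp μ U 0 U)) := by funext x; ring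
  have e4 : (fun x => (Y x - Tilt.tiltExp μ U 0 Y) * (c * U x - c * Tilt.tiltExp μ U 0 U)) =
      fun x => c * ((Y x - Tilt.tiltExp μ U 0 Y) * (U x - Tilt.tiltExp μ U 0 U)) := by funext x; ring
  rw [e1, e2, e3, e4, Tilt.tiltExp_const_mul, Tilt.tiltExp_const_mul, Tilt.tiltExp_const_mul, Tilt.tiltExp_const_mul]
  ring

/-- `κ₄,₀(X, Y; −U) = κ₄,₀(X, Y; U)`. -/
theorem tiltCum4_zero_neg_third {Ω : Type*} [MeasurableSpace Ω] (μ : Measure Ω) (U X Y : Ω → ℝ) :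
    Tilt.tiltCum4 μ (fun x => -U x) 0 X Y = Tilt.tiltCum4 μ U 0 X Y := by
  have h := tiltCum4_zero_const_mul_third μ U X Y (-1)
  simp only [neg_mul, one_mul] at h
  rw [h]; ring



end GaussRestrict

end Summit.QuantumFields.YangMills.Theorems.AllWindowsColdBoxBoxHighLine

end
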